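import Summits.Ventures.PercRepro.C025ProfilePLDCertificate

/-!
# THE PRESERVER `6·q₇′ = 6·T₂₇ + 14·T₃₇ + 25·T₄₇ + 35·T₅₇ + 41·T₆₇` AT RANK ≤ 8: A LIFTED CERTIFICATE TABLE — PART P (night-3 g34)

`proofs/NIGHT3-G34-FASTLIFT.md` §1 (the preservers of g31 §5, §7 and g32 §6).  For a (PLD)-matroid `M` of rank ≤ 8, the family of shifted pairs
`(ρI + a, ρ(E∖I) + b)` with multiplicities `w`, `(a, b, w)` ∈ [(2, 7, 6), (7, 2, 6), (3, 7, 14), (7, 3, 14), (4, 7, 25), (7, 4, 25), (5, 7, 35), (7, 5, 35), (6, 7, 41), (7, 6, 41)], satisfies every canonical (PLD) instance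
`lo ≤ hi ≤ 15`, `δ ≤ 15`, `Θ = 0` or `lo + hi + δ` — the symmetric-coordinate Farkas certificates (HiGHS vertex + exact rational reconstruction,
lab/certtab_q.py) verified pointwise on `[0,8]²` by `decide` (`q72_table_8_part0`) and fed to the certificate lemma
`PLDCert.sum_le_of_cert` (`pld_conv_q72_of_eRank_le_8`).  This is the preserver the lift in `m` needs (`lift_instance_plane` /
`lift_instance_solid`).  No `def`, no `instance`, no notation.  Axioms: standard.
-/

open scoped Matroid

namespace PercRepro

open Finset ThmH

namespace PLDPlaneTable

variable {α : Type} [DecidableEq α]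

set_option maxRecDepth 16384 in
set_option maxHeartbeats 256000000 in
/-- THE TABLE (part 30: δ ∈ [15, 16)): a pointwise symmetrised certificate for every canonical target, as a finite computation. -/
theorem q72_table_8_part30 :
    ∀ T : ℕ → ℕ → ℕ → ℕ × List (ℕ × ℕ × ℕ × ℕ × ℕ), T = (fun _ _ _ : ℕ => ((1 : ℕ), ([] : List (ℕ × ℕ × ℕ × ℕ × ℕ)))) →
          ∀ lo ∈ range 16, ∀ hi ∈ range 16, ∀ δ ∈ Ico 15 16, lo ≤ hi →
          0 < (T lo hi δ).1 ∧
          (∀ k ∈ (T lo hi δ).2, k.2.2.2.1 ≤ k.1 + k.2.1 + k.2.2.1 ∧ (k.1 = 0 ∨ k.1 + k.2.1 + k.2.2.1 ≤ k.2.2.2.1)) ∧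
          ∀ x ∈ range 9, ∀ f ∈ range 9,
            (T lo hi δ).1 * (6 * (if lo ≤ x + 2 ∧ x + 2 ≤ hi ∧ (if lo = 0 then 0 else lo + hi + δ) ≤ (f + 7) + (x + 2) then (f + 7).choose δ else 0) + 6 * (if lo ≤ x + 7 ∧ x + 7 ≤ hi ∧ (if lo = 0 then 0 else lo + hi + δ) ≤ (f + 2) + (x + 7) then (f + 2).choose δ else 0) + 14 * (if lo ≤ x + 3 ∧ x + 3 ≤ hi ∧ (if lo = 0 then 0 else lo + hi + δ) ≤ (f + 7) + (x + 3) then (f + 7).choose δ else 0) + 14 * (if lo ≤ x + 7 ∧ x + 7 ≤ hi ∧ (if lo = 0 then 0 else lo + hi + δ) ≤ (f + 3) + (x + 7) then (f + 3).choose δ else 0) + 25 * (if lo ≤ x + 4 ∧ x + 4 ≤ hi ∧ (if lo = 0 then 0 else lo + hi + δ) ≤ (f + 7) + (x + 4) then (f + 7).choose δ else 0) + 25 * (if lo ≤ x + 7 ∧ x + 7 ≤ hi ∧ (if lo = 0 then 0 else lo + hi + δ) ≤ (f + 4) + (x + 7) then (f + 4).choose δ else 0) + 35 * (if lo ≤ x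 + 5 ∧ x + 5 ≤ hi ∧ (if lo = 0 then 0 else lo + hi + δ) ≤ (f + 7) + (x + 5) then (f + 7).choose δ else 0) + 35 * (if lo ≤ x + 7 ∧ x + 7 ≤ hi ∧ (if lo = 0 then 0 else lo + hi + δ) ≤ (f + 5) + (x + 7) then (f + 5).choose δ else 0) + 41 * (if lo ≤ x + 6 ∧ x + 6 ≤ hi ∧ (if lo = 0 then 0 else lo + hi + δ) ≤ (f + 7) + (x + 6) then (f + 7).choose δ else 0) + 41 * (if lo ≤ x + 7 ∧ x + 7 ≤ hi ∧ (if lo = 0 then 0 else lo + hi + δ) ≤ (f + 6) + (x + 7) then (f + 6).choose δ else 0)) + (T lo hi δ).1 * (6 * (if lo ≤ f + 2 ∧ f + 2 ≤ hi ∧ (if lo = 0 then 0 else lo + hi + δ) ≤ (x + 7) + (f + 2) then (x + 7).choose δ else 0) + 6 * (if lo ≤ f + 7 ∧ f + 7 ≤ hi ∧ (if lo = 0 then 0 else lo + hi + δ) ≤ (x + 2) + (f + 7) then (x + 2).choose δ else 0) + 14 * (if lo ≤ f + 3 ∧ f + 3 ≤ hi ∧ (if lo = 0 then 0 else lo + hi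 + δ) ≤ (x + 7) + (f + 3) then (x + 7).choose δ else 0) + 14 * (if lo ≤ f + 7 ∧ f + 7 ≤ hi ∧ (if lo = 0 then 0 else lo + hi + δ) ≤ (x + 3) + (f + 7) then (x + 3).choose δ else 0) + 25 * (if lo ≤ f + 4 ∧ f + 4 ≤ hi ∧ (if lo = 0 then 0 else lo + hi + δ) ≤ (x + 7) + (f + 4) then (x + 7).choose δ else 0) + 25 * (if lo ≤ f + 7 ∧ f + 7 ≤ hi ∧ (if lo = 0 then 0 else lo + hi + δ) ≤ (x + 4) + (f + 7) then (x + 4).choose δ else 0) + 35 * (if lo ≤ f + 5 ∧ f + 5 ≤ hi ∧ (if lo = 0 then 0 else lo + hi + δ) ≤ (x + 7) + (f + 5) then (x + 7).choose δ else 0) + 35 * (if lo ≤ f + 7 ∧ f + 7 ≤ hi ∧ (if lo = 0 then 0 else lo + hi + δ) ≤ (x + 5) + (f + 7) then (x + 5).choose δ else 0) + 41 * (if lo ≤ f + 6 ∧ f + 6 ≤ hi ∧ (if lo = 0 then 0 else lo + hi + δ) ≤ (x + 7) + (f + 6) then (x + 7).choose δ else 0) + 41 * (if lo ≤ f + 7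 ∧ f + 7 ≤ hi ∧ (if lo = 0 then 0 else lo + hi + δ) ≤ (x + 6) + (f + 7) then (x + 6).choose δ else 0)) +
              (((T lo hi δ).2).map (fun k : (ℕ × ℕ × ℕ × ℕ × ℕ) => k.2.2.2.2 *
          ((if k.1 + k.2.2.1 ≤ f ∧ f ≤ k.2.1 + k.2.2.1 then f.choose k.2.2.1 else 0) +
            (if k.1 + k.2.2.1 ≤ x ∧ x ≤ k.2.1 + k.2.2.1 then x.choose k.2.2.1 else 0)))).sum ≤
            (T lo hi δ).1 * (6 * (if lo + δ ≤ f + 7 ∧ f + 7 ≤ hi + δ then (f + 7).choose δ else 0) + 6 * (if lo + δ ≤ f + 2 ∧ f + 2 ≤ hi + δ then (f + 2).choose δ else 0) + 14 * (if lo + δ ≤ f + 7 ∧ f + 7 ≤ hi + δ then (f + 7).choose δ else 0) + 14 * (if lo + δ ≤ f + 3 ∧ f + 3 ≤ hi + δ then (f + 3).choose δ else 0) + 25 * (if lo + δ ≤ f + 7 ∧ f + 7 ≤ hi + δ then (f + 7).choose δ else 0) + 25 * (if lo + δ ≤ f + 4 ∧ f + 4 ≤ hi + δ then (f + 4).choose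 δ else 0) + 35 * (if lo + δ ≤ f + 7 ∧ f + 7 ≤ hi + δ then (f + 7).choose δ else 0) + 35 * (if lo + δ ≤ f + 5 ∧ f + 5 ≤ hi + δ then (f + 5).choose δ else 0) + 41 * (if lo + δ ≤ f + 7 ∧ f + 7 ≤ hi + δ then (f + 7).choose δ else 0) + 41 * (if lo + δ ≤ f + 6 ∧ f + 6 ≤ hi + δ then (f + 6).choose δ else 0)) + (T lo hi δ).1 * (6 * (if lo + δ ≤ x + 7 ∧ x + 7 ≤ hi + δ then (x + 7).choose δ else 0) + 6 * (if lo + δ ≤ x + 2 ∧ x + 2 ≤ hi + δ then (x + 2).choose δ else 0) + 14 * (if lo + δ ≤ x + 7 ∧ x + 7 ≤ hi + δ then (x + 7).choose δ else 0) + 14 * (if lo + δ ≤ x + 3 ∧ x + 3 ≤ hi + δ then (x + 3).choose δ else 0) + 25 * (if lo + δ ≤ x + 7 ∧ x + 7 ≤ hi + δ then (x + 7).choose δ else 0) + 25 * (if lo + δ ≤ x + 4 ∧ x + 4 ≤ hi + δ then (x + 4).choose δ else 0) + 35 * (if lo + δ ≤ x + 7 ∧ x + 7 ≤ hi + δ then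 (x + 7).choose δ else 0) + 35 * (if lo + δ ≤ x + 5 ∧ x + 5 ≤ hi + δ then (x + 5).choose δ else 0) + 41 * (if lo + δ ≤ x + 7 ∧ x + 7 ≤ hi + δ then (x + 7).choose δ else 0) + 41 * (if lo + δ ≤ x + 6 ∧ x + 6 ≤ hi + δ then (x + 6).choose δ else 0)) +
              (((T lo hi δ).2).map (fun k : (ℕ × ℕ × ℕ × ℕ × ℕ) => k.2.2.2.2 *
          ((if k.1 ≤ x ∧ x ≤ k.2.1 ∧ k.2.2.2.1 ≤ f + x then f.choose k.2.2.1 else 0) +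
            (if k.1 ≤ f ∧ f ≤ k.2.1 ∧ k.2.2.2.1 ≤ x + f then x.choose k.2.2.1 else 0)))).sum := by
  intro T hT
  subst hT
  decide

set_option maxRecDepth 16384 in
set_option maxHeartbeats 256000000 in
/-- THE TABLE (part 31: δ ∈ [16, 16)): a pointwise symmetrised certificate for every canonical target, as a finite computation. -/
theorem q72_table_8_part31 :
    ∀ T : ℕ → ℕ → ℕ → ℕ × List (ℕ × ℕ × ℕ × ℕ × ℕ), T = (fun _ _ _ : ℕ => ((1 : ℕ), ([] : List (ℕ × ℕ × ℕ × ℕ × ℕ)))) →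
          ∀ lo ∈ range 16, ∀ hi ∈ range 16, ∀ δ ∈ Ico 16 16, lo ≤ hi →
          0 < (T lo hi δ).1 ∧
          (∀ k ∈ (T lo hi δ).2, k.2.2.2.1 ≤ k.1 + k.2.1 + k.2.2.1 ∧ (k.1 = 0 ∨ k.1 + k.2.1 + k.2.2.1 ≤ k.2.2.2.1)) ∧
          ∀ x ∈ range 9, ∀ f ∈ range 9,
            (T lo hi δ).1 * (6 * (if lo ≤ x + 2 ∧ x + 2 ≤ hi ∧ (if lo = 0 then 0 else lo + hi + δ) ≤ (f + 7) + (x + 2) then (f + 7).choose δ else 0) + 6 * (if lo ≤ x + 7 ∧ x + 7 ≤ hi ∧ (if lo = 0 then 0 else lo + hi + δ) ≤ (f + 2) + (x + 7) then (f + 2).choose δ else 0) + 14 * (if lo ≤ x + 3 ∧ x + 3 ≤ hi ∧ (if lo = 0 then 0 else lo + hi + δ) ≤ (f + 7) + (x + 3) then (f + 7).choose δ else 0) + 14 * (if lo ≤ x + 7 ∧ x + 7 ≤ hi ∧ (if lo = 0 then 0 else lo + hi + δ) ≤ (f + 3) + (x + 7) then (f + 3).choose δ else 0) + 25 * (if lo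 ≤ x + 4 ∧ x + 4 ≤ hi ∧ (if lo = 0 then 0 else lo + hi + δ) ≤ (f + 7) + (x + 4) then (f + 7).choose δ else 0) + 25 * (if lo ≤ x + 7 ∧ x + 7 ≤ hi ∧ (if lo = 0 then 0 else lo + hi + δ) ≤ (f + 4) + (x + 7) then (f + 4).choose δ else 0) + 35 * (if lo ≤ x + 5 ∧ x + 5 ≤ hi ∧ (if lo = 0 then 0 else lo + hi + δ) ≤ (f + 7) + (x + 5) then (f + 7).choose δ else 0) + 35 * (if lo ≤ x + 7 ∧ x + 7 ≤ hi ∧ (if lo = 0 then 0 else lo + hi + δ) ≤ (f + 5) + (x + 7) then (f + 5).choose δ else 0) + 41 * (if lo ≤ x + 6 ∧ x + 6 ≤ hi ∧ (if lo = 0 then 0 else lo + hi + δ) ≤ (f + 7) + (x + 6) then (f + 7).choose δ else 0) + 41 * (if lo ≤ x + 7 ∧ x + 7 ≤ hi ∧ (if lo = 0 then 0 else lo + hi + δ) ≤ (f + 6) + (x + 7) then (f + 6).choose δ else 0)) + (T lo hi δ).1 * (6 * (if lo ≤ f + 2 ∧ f + 2 ≤ hi ∧ (if lo = 0 then 0 else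 lo + hi + δ) ≤ (x + 7) + (f + 2) then (x + 7).choose δ else 0) + 6 * (if lo ≤ f + 7 ∧ f + 7 ≤ hi ∧ (if lo = 0 then 0 else lo + hi + δ) ≤ (x + 2) + (f + 7) then (x + 2).choose δ else 0) + 14 * (if lo ≤ f + 3 ∧ f + 3 ≤ hi ∧ (if lo = 0 then 0 else lo + hi + δ) ≤ (x + 7) + (f + 3) then (x + 7).choose δ else 0) + 14 * (if lo ≤ f + 7 ∧ f + 7 ≤ hi ∧ (if lo = 0 then 0 else lo + hi + δ) ≤ (x + 3) + (f + 7) then (x + 3).choose δ else 0) + 25 * (if lo ≤ f + 4 ∧ f + 4 ≤ hi ∧ (if lo = 0 then 0 else lo + hi + δ) ≤ (x + 7) + (f + 4) then (x + 7).choose δ else 0) + 25 * (if lo ≤ f + 7 ∧ f + 7 ≤ hi ∧ (if lo = 0 then 0 else lo + hi + δ) ≤ (x + 4) + (f + 7) then (x + 4).choose δ else 0) + 35 * (if lo ≤ f + 5 ∧ f + 5 ≤ hi ∧ (if lo = 0 then 0 else lo + hi + δ) ≤ (x + 7) + (f + 5) then (x + 7).choose δ else 0) + 35 * (if lo ≤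 f + 7 ∧ f + 7 ≤ hi ∧ (if lo = 0 then 0 else lo + hi + δ) ≤ (x + 5) + (f + 7) then (x + 5).choose δ else 0) + 41 * (if lo ≤ f + 6 ∧ f + 6 ≤ hi ∧ (if lo = 0 then 0 else lo + hi + δ) ≤ (x + 7) + (f + 6) then (x + 7).choose δ else 0) + 41 * (if lo ≤ f + 7 ∧ f + 7 ≤ hi ∧ (if lo = 0 then 0 else lo + hi + δ) ≤ (x + 6) + (f + 7) then (x + 6).choose δ else 0)) +
              (((T lo hi δ).2).map (fun k : (ℕ × ℕ × ℕ × ℕ × ℕ) => k.2.2.2.2 *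
          ((if k.1 + k.2.2.1 ≤ f ∧ f ≤ k.2.1 + k.2.2.1 then f.choose k.2.2.1 else 0) +
            (if k.1 + k.2.2.1 ≤ x ∧ x ≤ k.2.1 + k.2.2.1 then x.choose k.2.2.1 else 0)))).sum ≤
            (T lo hi δ).1 * (6 * (if lo + δ ≤ f + 7 ∧ f + 7 ≤ hi + δ then (f + 7).choose δ else 0) + 6 * (if lo + δ ≤ f + 2 ∧ f + 2 ≤ hi + δ then (f + 2).choose δ else 0) + 14 * (if lo + δ ≤ f + 7 ∧ f + 7 ≤ hi + δ then (f + 7).choose δ else 0) + 14 * (if lo + δ ≤ f + 3 ∧ f + 3 ≤ hi + δ then (f + 3).choose δ else 0) + 25 * (if lo + δ ≤ f + 7 ∧ f + 7 ≤ hi + δ then (f + 7).choose δ else 0) + 25 * (if lo + δ ≤ f + 4 ∧ f + 4 ≤ hi + δ then (f + 4).choose δ else 0) + 35 * (if lo + δ ≤ f + 7 ∧ f + 7 ≤ hi + δ then (f + 7).choose δ else 0) + 35 * (if lo + δ ≤ f + 5 ∧ f + 5 ≤ hi + δ then (f + 5).choose δ else 0) + 41 * (if lo + δ ≤ f + 7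 ∧ f + 7 ≤ hi + δ then (f + 7).choose δ else 0) + 41 * (if lo + δ ≤ f + 6 ∧ f + 6 ≤ hi + δ then (f + 6).choose δ else 0)) + (T lo hi δ).1 * (6 * (if lo + δ ≤ x + 7 ∧ x + 7 ≤ hi + δ then (x + 7).choose δ else 0) + 6 * (if lo + δ ≤ x + 2 ∧ x + 2 ≤ hi + δ then (x + 2).choose δ else 0) + 14 * (if lo + δ ≤ x + 7 ∧ x + 7 ≤ hi + δ then (x + 7).choose δ else 0) + 14 * (if lo + δ ≤ x + 3 ∧ x + 3 ≤ hi + δ then (x + 3).choose δ else 0) + 25 * (if lo + δ ≤ x + 7 ∧ x + 7 ≤ hi + δ then (x + 7).choose δ else 0) + 25 * (if lo + δ ≤ x + 4 ∧ x + 4 ≤ hi + δ then (x + 4).choose δ else 0) + 35 * (if lo + δ ≤ x + 7 ∧ x + 7 ≤ hi + δ then (x + 7).choose δ else 0) + 35 * (if lo + δ ≤ x + 5 ∧ x + 5 ≤ hi + δ then (x + 5).choose δ else 0) + 41 * (if lo + δ ≤ x + 7 ∧ x + 7 ≤ hi + δ then (x + 7).choose δ else 0) + 41 * (if lo + δ ≤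 x + 6 ∧ x + 6 ≤ hi + δ then (x + 6).choose δ else 0)) +
              (((T lo hi δ).2).map (fun k : (ℕ × ℕ × ℕ × ℕ × ℕ) => k.2.2.2.2 *
          ((if k.1 ≤ x ∧ x ≤ k.2.1 ∧ k.2.2.2.1 ≤ f + x then f.choose k.2.2.1 else 0) +
            (if k.1 ≤ f ∧ f ≤ k.2.1 ∧ k.2.2.2.1 ≤ x + f then x.choose k.2.2.1 else 0)))).sum := by
  intro T hT
  subst hT
  decide

end PLDPlaneTable

end PercRepro
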